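import Literature.NumberTheory.LFunctions.HybridCharSumLFunction
import HarnessLib

/-!
# Hybrid character sums over extension fields are the `S_ν` of the `L`-function (Schmidt, Ch. II §10)

Topic `Literature/NumberTheory/LFunctions` (exponential sums), grouping namespace `HybridLFunction`.
W. M. Schmidt, *Equations over Finite Fields. An Elementary Approach*, LNM 536 (1976), Ch. II
§10, Theorem 10A: for the character sums lifted to `𝔽_{q^ν}` along the norm `𝔑` and the trace `𝔗`
("`χ_ν(x) = χ(𝔑(x))`, `ψ_ν(x) = ψ(𝔗(x))`", (10.1)–(10.3)) one has
`S_ν = Σ_{x ∈ 𝔽_{q^ν}} χ_ν(f(x)) ψ_ν(g(x)) = Σ_{P, j : j deg P = ν} deg P · X(P)^j`, the `ν`-th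
coefficient of `U L'/L` (proof: group `x` by its minimal polynomial `P`; a monic irreducible `P`
of degree `k ∣ ν` has `k` roots in `𝔽_{q^ν}`, each contributing `X(P)^{ν/k}` by (10.5)
`𝔗_ν = (ν/k) 𝔗_k`, `𝔑_ν = 𝔑_k^{ν/k}`). We PROVE this for the hybrid function
`lam χ ψ c r b` of `HybridCharSumLFunction.lean` (split `f = c Π_{i<ℓ} (X − r_i)`, `g = bX`) and
the quadratic character, over an arbitrary finite extension `E/F` of finite fields of odd
characteristic:

* `quadChar F` — the quadratic character of `F` with complex values, `quadChar_ne_one`;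
* `quadChar_eq_quadChar_norm` — **`χ_E = χ_F ∘ N_{E/F}`** for the quadratic characters (Euler's
  criterion in `E` and `F` and `N(y) = y^{(q^ν−1)/(q−1)}`, Mathlib's
  `FiniteField.algebraMap_norm_eq_pow_sum`);
* `norm_sub_algebraMap` — `N_{E/F}(x − a) = ((−1)^k P(a))^{ν/k}` for `P = minpoly x` of degree `k`
  (`a ∈ F`), and `norm_splitPoly`: `N_{E/F}(c Π_i (x − r_i)) = (c^k (−1)^{ℓk} Π_i P(r_i))^{ν/k}`;
* `trace_algebraMap_mul` — `𝔗(bx) = (ν/k)·(−b·nextCoeff P)` ((10.5));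
* `extSum ψ c r b E = Σ_{x ∈ E} χ_E(c Π_i (x − r_i)) ψ(𝔗_{E/F}(bx))` and
  **`extSum_eq_psumOf`**: `extSum ψ c r b E = psumOf (lam (quadChar F) ψ c r b) [E : F]`
  (Theorem 10A for this `L`-function). [cite: Schmidt1976, Ch. II §10, (10.1)–(10.5), Theorem 10A]

## References

* W. M. Schmidt, *Equations over Finite Fields. An Elementary Approach*, Lecture Notes in
  Math. 536, Springer (1976), Ch. II §10.
-/

noncomputable section

open Finset Polynomial IntermediateField

namespace Literature.NumberTheory.LFunctions

open KloostermanLFunction (irrMonicsLE mem_irrMonicsLE one_le_natDegree_of_irreducible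
  card_filter_aeval_eq_zero natDegree_minpoly_mul_finrank minpoly_eq_of_aeval_eq_zero)

namespace HybridLFunction

/-! ### The quadratic character with complex values; `χ_E = χ_F ∘ N` -/

section QuadChar

variable (F : Type*) [Field F] [Fintype F] [DecidableEq F]

/-- The quadratic character of a finite field, with complex values. [folklore] -/
def quadChar : MulChar F ℂ := (quadraticChar F).ringHomComp (Int.castRingHom ℂ)

/-- `quadChar F a = quadraticChar F a` (as a complex number). [folklore] -/
theorem quadChar_apply (a : F) : quadChar F a = (quadraticChar F a : ℂ) := rfl

/-- `‖quadChar F a‖ ≤ 1`. [folklore] -/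
theorem norm_quadChar_le (a : F) : ‖quadChar F a‖ ≤ 1 := by
  rw [quadChar_apply]
  by_cases ha : a = 0
  · rw [ha, MulChar.map_zero, Int.cast_zero, norm_zero]; exact zero_le_one
  · rcases quadraticChar_dichotomy ha with h | h <;> rw [h] <;> simp

/-- In odd characteristic the quadratic character is non-trivial. [folklore] -/
theorem quadChar_ne_one (hF : ringChar F ≠ 2) : quadChar F ≠ 1 := by
  obtain ⟨a, ha⟩ := quadraticChar_exists_neg_one hF
  have ha0 : a ≠ 0 := by rintro rfl; simp at ha
  intro h
  have h1 : quadChar F a = 1 := by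
    rw [h, MulChar.one_apply (isUnit_iff_ne_zero.mpr ha0)]
  rw [quadChar_apply, ha] at h1
  norm_num at h1

variable (E : Type*) [Field E] [Fintype E] [DecidableEq E] [Algebra F E]

/-- `Σ_{i<ν} q^i · (q − 1) = q^ν − 1` in `ℕ`. [folklore] -/
theorem geomSum_mul_pred (q ν : ℕ) (hq : 1 ≤ q) :
    (∑ i ∈ Finset.range ν, q ^ i) * (q - 1) = q ^ ν - 1 := by
  induction ν with
  | zero => simp
  | succ ν ih =>
    rw [Finset.sum_range_succ, add_mul, ih, pow_succ]
    have h1 : 1 ≤ q ^ ν := Nat.one_le_pow _ _ hq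
    zify [hq, h1, Nat.one_le_pow _ _ hq, (show 1 ≤ q ^ ν * q from by nlinarith)]
    ring

/-- **`χ_E = χ_F ∘ N_{E/F}`** for the quadratic characters of a finite extension of finite fields of
odd characteristic: `y` is a square in `E` iff `N_{E/F}(y)` is a square in `F` (Euler's criterion
`y^{(Q−1)/2}`, `N(y)^{(q−1)/2}` with `N(y) = y^{(Q−1)/(q−1)}`; Schmidt's "`χ_ν(x) = χ(𝔑(x))` is
a character of order `d` of `𝔽_{q^ν}`", (10.1)). [cite: Schmidt1976, Ch. II §10, (10.1)] -/
theorem quadraticChar_eq_quadraticChar_norm (hF : ringChar F ≠ 2) (y : E) :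
    quadraticChar E y = quadraticChar F (Algebra.norm F y) := by
  have hE : ringChar E ≠ 2 := by rw [← Algebra.ringChar_eq F E]; exact hF
  by_cases hy : y = 0
  · rw [hy, Algebra.norm_zero, MulChar.map_zero, MulChar.map_zero]
  have hN : Algebra.norm F y ≠ 0 := Algebra.norm_ne_zero_iff.mpr hy
  -- the exponent arithmetic `(Σ_{i<ν} q^i) · ((q-1)/2) = (q^ν - 1)/2`
  set q := Fintype.card F with hq
  set ν := Module.finrank F E with hν
  have hcardE : Fintype.card E = q ^ ν := Module.card_eq_pow_finrank
  have hq1 : 1 < q := Fintype.one_lt_card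
  have hqodd : q % 2 = 1 := FiniteField.odd_card_of_char_ne_two hF
  have hQodd : (q ^ ν) % 2 = 1 := by
    rw [Nat.pow_mod, hqodd, one_pow]
    norm_num
  set A := ∑ i ∈ Finset.range ν, q ^ i with hA
  have hAq : A * (q - 1) = q ^ ν - 1 := geomSum_mul_pred q ν hq1.le
  have hexp : A * (q / 2) = q ^ ν / 2 := by
    set B := A * (q / 2) with hB
    have h2 : A * (q - 1) = 2 * B := by
      rw [hB, ← mul_assoc, mul_comm 2, mul_assoc]; congr 1; omega
    omega
  -- `IsSquare y ↔ IsSquare (N y)`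
  have key : IsSquare y ↔ IsSquare (Algebra.norm F y) := by
    rw [FiniteField.isSquare_iff hE hy, FiniteField.isSquare_iff hF hN, hcardE,
      ← (algebraMap F E).injective.eq_iff, map_pow, map_one,
      FiniteField.algebraMap_norm_eq_pow_sum, Nat.card_eq_fintype_card, ← pow_mul, ← hA, hexp]
  rcases quadraticChar_dichotomy hy with h1 | h1 <;>
    rcases quadraticChar_dichotomy hN with h2 | h2
  · rw [h1, h2]
  · exfalso
    have hs : IsSquare y := (quadraticChar_one_iff_isSquare hy).mp h1
    have := (quadraticChar_one_iff_isSquare hN).mpr (key.mp hs)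
    rw [h2] at this; norm_num at this
  · exfalso
    have hs : IsSquare (Algebra.norm F y) := (quadraticChar_one_iff_isSquare hN).mp h2
    have := (quadraticChar_one_iff_isSquare hy).mpr (key.mpr hs)
    rw [h1] at this; norm_num at this
  · rw [h1, h2]

/-- `χ_E = χ_F ∘ N_{E/F}` for the complex-valued quadratic characters. [cite: Schmidt1976, Ch. II §10, (10.1)] -/
theorem quadChar_eq_quadChar_norm (hF : ringChar F ≠ 2) (y : E) :
    quadChar E y = quadChar F (Algebra.norm F y) := by
  rw [quadChar_apply, quadChar_apply, quadraticChar_eq_quadraticChar_norm F E hF y]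

end QuadChar

/-! ### Norms and traces of `x − a`, `c Π (x − r_i)`, `bx` via the minimal polynomial of `x` -/

section NormTrace

variable {F : Type*} [Field F] {E : Type*} [Field E] [Fintype E] [Algebra F E]

/-- The minimal polynomial of an element of a finite field has positive degree. [folklore] -/
theorem natDegree_minpoly_pos (x : E) : 0 < (minpoly F x).natDegree :=
  natDegree_pos_iff_degree_pos.mpr (minpoly.degree_pos (.of_finite F x))

/-- `[E : F] / deg minpoly(x) = [E : F(x)]`. [folklore] -/
theorem finrank_div_natDegree_minpoly (x : E) :
    Module.finrank F E / (minpoly F x).natDegree = Module.finrank F⟮x⟯ E := by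
  rw [← natDegree_minpoly_mul_finrank (F := F) x, Nat.mul_div_cancel_left _ (natDegree_minpoly_pos x)]

/-- `deg minpoly(x) · ([E : F] / deg minpoly(x)) = [E : F]`. [folklore] -/
theorem natDegree_minpoly_mul_div (x : E) :
    (minpoly F x).natDegree * (Module.finrank F E / (minpoly F x).natDegree) = Module.finrank F E := by
  rw [finrank_div_natDegree_minpoly, natDegree_minpoly_mul_finrank]

/-- **`N_{E/F}(x − a) = ((−1)^k P(a))^{[E:F]/k}`** for `a ∈ F`, `P = minpoly_F(x)` of degree `k`:
the minimal polynomial of `x − a` is `P(X + a)`, whose constant coefficient is `P(a)`, and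
`N_{E/F} = N_{F(x−a)/F}^{[E:F(x−a)]}` (Schmidt's "`𝔑_ν = 𝔑_k^{ν/k}`", (10.5), with
`𝔑_{F(β)/F}(β) = (−1)^k h(0)` for `h = minpoly β`). [cite: Schmidt1976, Ch. II §10, (10.5)] -/
theorem norm_sub_algebraMap (x : E) (a : F) :
    Algebra.norm F (x - algebraMap F E a) =
      ((-1) ^ (minpoly F x).natDegree * (minpoly F x).eval a) ^
        (Module.finrank F E / (minpoly F x).natDegree) := by
  set y := x - algebraMap F E a with hy
  have hyi : IsIntegral F y := .of_finite F y
  have hmin : minpoly F y = (minpoly F x).comp (X + C a) := minpoly.sub_algebraMap x a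
  have hdeg : (minpoly F y).natDegree = (minpoly F x).natDegree := by
    rw [hmin, natDegree_comp, natDegree_X_add_C, mul_one]
  have hcoeff : (minpoly F y).coeff 0 = (minpoly F x).eval a := by
    rw [hmin, coeff_zero_eq_eval_zero, eval_comp, eval_add, eval_X, eval_C, zero_add]
  have hgen : Algebra.norm F (AdjoinSimple.gen F y) =
      (-1) ^ (minpoly F y).natDegree * (minpoly F y).coeff 0 := by
    rw [← adjoin.powerBasis_gen hyi, Algebra.PowerBasis.norm_gen_eq_coeff_zero_minpoly,
      adjoin.powerBasis_dim, adjoin.powerBasis_gen, minpoly_gen]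
  have hfin : Module.finrank F⟮y⟯ E = Module.finrank F E / (minpoly F x).natDegree := by
    rw [← finrank_div_natDegree_minpoly y, hdeg]
  rw [Algebra.norm_eq_norm_adjoin F y, hgen, hdeg, hcoeff, hfin]

/-- **`N_{E/F}(c Π_i (x − r_i)) = (c^k (−1)^{ℓk} Π_i P(r_i))^{[E:F]/k}`** (`P = minpoly x`,
`k = deg P`): the norm of the value at `x` of the split polynomial `f = c Π_{i<ℓ} (X − r_i)` is the
`[E:F]/k`-th power of Schmidt's `{f/P} = Π_{P(β)=0} f(β)`. [cite: Schmidt1976, Ch. II §9 and §10 (10.5)] -/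
theorem norm_splitPoly (x : E) (c : F) {ℓ : ℕ} (r : Fin ℓ → F) :
    Algebra.norm F (algebraMap F E c * ∏ i, (x - algebraMap F E (r i))) =
      (c ^ (minpoly F x).natDegree * (-1) ^ (ℓ * (minpoly F x).natDegree) *
        ∏ i, (minpoly F x).eval (r i)) ^ (Module.finrank F E / (minpoly F x).natDegree) := by
  set k := (minpoly F x).natDegree with hk
  set m := Module.finrank F E / k with hm
  have hkm : k * m = Module.finrank F E := natDegree_minpoly_mul_div x
  rw [map_mul, map_prod, Algebra.norm_algebraMap, ← hkm, pow_mul]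
  simp only [norm_sub_algebraMap, ← hk, ← hm]
  rw [Finset.prod_pow, ← mul_pow, Finset.prod_mul_distrib, Finset.prod_const, Finset.card_univ,
    Fintype.card_fin, ← pow_mul]
  ring

/-- **`𝔗_{E/F}(bx) = ([E:F]/k)·(−b · nextCoeff P)`** for `b ∈ F`, `P = minpoly x` of degree `k`
(the trace of `x` is `[E : F(x)]` times the sum of the roots of `P`; Schmidt's
"`𝔗_ν = (ν/k) 𝔗_k`", (10.5)). [cite: Schmidt1976, Ch. II §10, (10.5)] -/
theorem trace_algebraMap_mul (x : E) (b : F) :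
    Algebra.trace F E (algebraMap F E b * x) =
      (Module.finrank F E / (minpoly F x).natDegree) • (-(b * (minpoly F x).nextCoeff)) := by
  rw [finrank_div_natDegree_minpoly, ← Algebra.smul_def, map_smul, smul_eq_mul,
    trace_eq_finrank_mul_minpoly_nextCoeff, nsmul_eq_mul]
  ring

end NormTrace

/-! ### The extension sums `S_E` and Theorem 10A -/

section ExtSum

variable {F : Type*} [Field F] [Fintype F] [DecidableEq F]

/-- The hybrid sum of `f = c Π_{i<ℓ} (X − r_i)` and `g = bX` lifted to a finite extension `E ⊇ F`:
`S_E = Σ_{x ∈ E} χ_E(c Π_i (x − r_i)) ψ(𝔗_{E/F}(bx))`, `χ_E` the quadratic character of `E`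
(Schmidt's `S_ν` with `χ_ν = χ ∘ 𝔑`, `ψ_ν = ψ ∘ 𝔗`, (10.1)–(10.3)).
[cite: Schmidt1976, Ch. II §10, (10.3)] -/
def extSum (ψ : AddChar F ℂ) (c : F) {ℓ : ℕ} (r : Fin ℓ → F) (b : F) (E : Type*) [Field E]
    [Fintype E] [DecidableEq E] [Algebra F E] : ℂ :=
  ∑ x : E, quadChar E (algebraMap F E c * ∏ i, (x - algebraMap F E (r i))) *
    ψ (Algebra.trace F E (algebraMap F E b * x))

variable (ψ : AddChar F ℂ) (c : F) {ℓ : ℕ} (r : Fin ℓ → F) (b : F)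
variable (E : Type*) [Field E] [Fintype E] [DecidableEq E] [Algebra F E]

/-- **Each summand of `S_E` is `λ(P)^{[E:F]/deg P}`**, `P` the minimal polynomial of `x`
(by `χ_E = χ_F ∘ 𝔑`, `norm_splitPoly` and `trace_algebraMap_mul`). [cite: Schmidt1976, Ch. II §10, proof of Theorem 10A] -/
theorem summand_eq_lam_pow (hF : ringChar F ≠ 2) (x : E) :
    quadChar E (algebraMap F E c * ∏ i, (x - algebraMap F E (r i))) *
        ψ (Algebra.trace F E (algebraMap F E b * x)) =
      lam (quadChar F) ψ c r b (minpoly F x) ^ (Module.finrank F E / (minpoly F x).natDegree) := by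
  rw [quadChar_eq_quadChar_norm F E hF, norm_splitPoly, trace_algebraMap_mul, map_pow,
    AddChar.map_nsmul_eq_pow, ← mul_pow]
  rfl

/-- **Schmidt, Ch. II, Theorem 10A for the hybrid `L`-function — PROVED:**
`S_E = psumOf λ [E:F]`, i.e. the lifted hybrid sum over a finite extension `E/F` of degree `ν`
equals the `ν`-th coefficient `Σ_{P, j : j deg P = ν} deg P · λ(P)^j` of `U L'/L` (group `x ∈ E`
by its minimal polynomial; a monic irreducible `P` of degree `k` has `k` roots in `E` if `k ∣ ν`
and none otherwise, each contributing `λ(P)^{ν/k}`). [cite: Schmidt1976, Ch. II §10, Theorem 10A] -/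
theorem extSum_eq_psumOf (hF : ringChar F ≠ 2) :
    extSum ψ c r b E = psumOf (lam (quadChar F) ψ c r b) (Module.finrank F E) := by
  classical
  set Λ := lam (quadChar F) ψ c r b with hΛ
  set ν := Module.finrank F E with hν
  have hνpos : 0 < ν := Module.finrank_pos
  -- every minimal polynomial lies in `irrMonicsLE ν`
  have hmem : ∀ x : E, minpoly F x ∈ irrMonicsLE (F := F) ν := by
    intro x
    rw [mem_irrMonicsLE]
    refine ⟨minpoly.monic (.of_finite F x), minpoly.irreducible (.of_finite F x), ?_⟩
    exact Nat.le_of_dvd hνpos (Dvd.intro _ (natDegree_minpoly_mul_finrank x))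
  -- group the sum by minimal polynomials
  unfold extSum
  rw [← Finset.sum_fiberwise_of_maps_to (g := fun x : E => minpoly F x)
    (t := irrMonicsLE (F := F) ν) (fun x _ => hmem x)]
  -- evaluate `psumOf Λ ν` as a sum over `P` with `deg P ∣ ν`
  have hpsum : psumOf Λ ν = ∑ P ∈ irrMonicsLE (F := F) ν,
      if P.natDegree ∣ ν then (P.natDegree : ℂ) * Λ P ^ (ν / P.natDegree) else 0 := by
    unfold psumOf
    rw [Finset.sum_filter, Finset.sum_product]
    refine Finset.sum_congr rfl fun P hP => ?_
    dsimp only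
    have hk : 1 ≤ P.natDegree := one_le_natDegree_of_irreducible (mem_irrMonicsLE.mp hP).2.1
    split_ifs with hdvd
    · rw [Finset.sum_eq_single (ν / P.natDegree)]
      · rw [if_pos (Nat.div_mul_cancel hdvd)]
      · intro j _ hj
        rw [if_neg]
        intro h
        exact hj (Nat.div_eq_of_eq_mul_left (by omega) h.symm).symm
      · intro h
        exfalso
        apply h
        rw [Finset.mem_Icc]
        exact ⟨Nat.div_pos (Nat.le_of_dvd hνpos hdvd) (by omega), Nat.div_le_self _ _⟩
    · apply Finset.sum_eq_zero
      intro j _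
      rw [if_neg]
      intro h
      exact hdvd (Dvd.intro_left _ h)
  rw [hpsum]
  refine Finset.sum_congr rfl fun P hP => ?_
  obtain ⟨hPm, hPi, -⟩ := mem_irrMonicsLE.mp hP
  have hval : ∀ x ∈ Finset.univ.filter (fun x : E => minpoly F x = P),
      quadChar E (algebraMap F E c * ∏ i, (x - algebraMap F E (r i))) *
          ψ (Algebra.trace F E (algebraMap F E b * x)) = Λ P ^ (ν / P.natDegree) := by
    intro x hx
    simp only [Finset.mem_filter, Finset.mem_univ, true_and] at hx
    rw [summand_eq_lam_pow ψ c r b E hF x, hx]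
  rw [Finset.sum_congr rfl hval, Finset.sum_const, nsmul_eq_mul]
  have hfib : (Finset.univ.filter fun x : E => minpoly F x = P) =
      Finset.univ.filter fun x : E => aeval x P = 0 := by
    ext x
    simp only [Finset.mem_filter, Finset.mem_univ, true_and]
    constructor
    · rintro rfl
      exact minpoly.aeval F x
    · intro hx
      exact minpoly_eq_of_aeval_eq_zero hPm hPi hx
  rw [hfib, card_filter_aeval_eq_zero hPm hPi]
  split_ifs with hdvd
  · rfl
  · rw [Nat.cast_zero, zero_mul]

/-- `S_F` (the trivial extension) is the hybrid sum itself: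
`extSum ψ c r b F = Σ_{x ∈ F} χ(c Π_i (x − r_i)) ψ(bx)`. [folklore] -/
theorem extSum_self :
    extSum ψ c r b F = ∑ x : F, quadChar F (c * ∏ i, (x - r i)) * ψ (b * x) := by
  unfold extSum
  simp only [Algebra.algebraMap_self, RingHom.id_apply, Algebra.trace_self_apply]

end ExtSum

end HybridLFunction

end Literature.NumberTheory.LFunctions
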